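import Literature.MeasureTheory.Jensen.GibbsInequality

/-!
# DV transfer for the line `block-h-dissipation-closure` (crux `AdaptedWeightCLT`, stmt-AtomisticToContinuum-14868),
# file 1: the Donsker–Varadhan / Gibbs variational inequality in density form

Support file (`--supports stmt-AtomisticToContinuum-14868`, anchor `bhDVTransfer_dv_anchor`) of the line lead
`prover-line-stmt-AtomisticToContinuum-14868-c4-0`, written for the registered stub `stub_dvTransfer` (S2 of the
skeleton `Cruxes/AdaptedWeightCLT/Lines/block_h_dissipation_closure.lean`): the residue `EntropyChaosRelOn` is turned
into the one-sided inequality `OneSidedOn` by the Donsker–Varadhan inequality on the space `Quad` of contact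
quadruples, applied to the smeared contact density `p = contactDens` (mass `n = contactMass`) against the chaos
reference `q = chaosDens` with the test function `φ = ½ ΔΛ` (TRIAGE-r1-3 Panel note A(5) of the crux).

This file is the measure-theoretic core, on a general measure space `(α, μ)` and in DENSITY form (the vocabulary
of the line works with densities on `Quad`, not with measures):

* `integral_mul_le_klDens_add_mul_log` — for a nonnegative integrable density `p` of mass `n = ∫ p dμ`, an
  a.e. positive probability density `q` and a test function `φ` (with `p log p`, `p log q`, `φ p`, `e^φ q`
  integrable): `∫ φ p dμ ≤ ∫ p log (p / (n q)) dμ + n log ∫ e^φ q dμ` (`= n KL(p/n ‖ q) + n log ∫ e^φ q`);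
* `mul_one_sub_integral_exp_sub_klDens_le` — the form consumed by the transfer, after `log u ≤ u − 1`:
  `n (1 − ∫ e^φ q dμ) − ∫ p log (p / (n q)) dμ ≤ −∫ φ p dμ`
  (realised `≥` chaotic exponential defect `−` relative entropy);
* `klDens_nonneg` — Gibbs' inequality `0 ≤ ∫ p log (p / (n q)) dμ` in the same density form;
* `integral_mul_log_div_eq` — the bookkeeping identity `∫ p log (p/(n q)) = ∫ p log p − ∫ p log q − n log n`.

Everything is a corollary of the tree's Gibbs variational inequality
`Literature.MeasureTheory.Jensen.neg_integral_mul_log_le_integral_mul_add_log_integral_exp_neg` (density `p / n`,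
potential `V = −φ − log q`). Mass `n = 0` is allowed (then `p = 0` a.e. and every term vanishes). No definitions.

References: M. D. Donsker, S. R. S. Varadhan, *Asymptotic evaluation of certain Markov process expectations for
large time I*, Comm. Pure Appl. Math. 28 (1975) (variational formula); T. M. Cover, J. A. Thomas, *Elements of
Information Theory* (2006) Thm. 2.6.3 (Gibbs' inequality) [CoverThomas2006].
-/

namespace Summit.AtomisticToContinuum.HydrodynamicLimit.Theorems.BlockHDissipation

open MeasureTheory Real Filter Set

noncomputable section

namespace DVTransfer

variable {α : Type*} [MeasurableSpace α] {μ : Measure α}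

/-- Pointwise bookkeeping: for `0 ≤ p`, `0 < q`, `0 < n`,
`p log (p / (n q)) = p log p − p log q − p log n` (both sides vanish at `p = 0`). -/
theorem mul_log_div_eq {p q n : ℝ} (hp : 0 ≤ p) (hq : 0 < q) (hn : 0 < n) :
    p * log (p / (n * q)) = p * log p - p * log q - p * log n := by
  rcases hp.eq_or_lt with h | h
  · rw [← h]; simp
  · rw [log_div h.ne' (mul_pos hn hq).ne', log_mul hn.ne' hq.ne']
    ring

/-- The relative-entropy density integrates to `∫ p log p − ∫ p log q − n log n` (`n = ∫ p`), for a nonnegative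
integrable `p` with `p log p`, `p log q` integrable and `q > 0` a.e.; mass `n = 0` included. -/
theorem integral_mul_log_div_eq {p q : α → ℝ} (hp0 : 0 ≤ᵐ[μ] p) (hq0 : ∀ᵐ x ∂μ, 0 < q x)
    (hp : Integrable p μ) (hplogp : Integrable (fun x => p x * log (p x)) μ)
    (hplogq : Integrable (fun x => p x * log (q x)) μ) :
    ∫ x, p x * log (p x / ((∫ y, p y ∂μ) * q x)) ∂μ =
      ∫ x, p x * log (p x) ∂μ - ∫ x, p x * log (q x) ∂μ - (∫ y, p y ∂μ) * log (∫ y, p y ∂μ) := by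
  set n : ℝ := ∫ y, p y ∂μ with hn
  have hn0 : 0 ≤ n := integral_nonneg_of_ae hp0
  rcases hn0.eq_or_lt with hz | hpos
  · -- mass zero: `p = 0` a.e.
    have hpz : p =ᵐ[μ] 0 := (integral_eq_zero_iff_of_nonneg_ae hp0 hp).1 hz.symm
    have h1 : (fun x => p x * log (p x / (n * q x))) =ᵐ[μ] fun _ => (0 : ℝ) := by
      filter_upwards [hpz] with x hx; simp [hx]
    have h2 : (fun x => p x * log (p x)) =ᵐ[μ] fun _ => (0 : ℝ) := by
      filter_upwards [hpz] with x hx; simp [hx]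
    have h3 : (fun x => p x * log (q x)) =ᵐ[μ] fun _ => (0 : ℝ) := by
      filter_upwards [hpz] with x hx; simp [hx]
    rw [integral_congr_ae h1, integral_congr_ae h2, integral_congr_ae h3, ← hz]
    simp
  · have hpt : (fun x => p x * log (p x / (n * q x))) =ᵐ[μ]
        fun x => p x * log (p x) - p x * log (q x) - p x * log n := by
      filter_upwards [hp0, hq0] with x hx hqx using mul_log_div_eq hx hqx hpos
    have h1 : Integrable (fun x => p x * log (p x) - p x * log (q x)) μ := hplogp.sub hplogq
    have h2 : Integrable (fun x => p x * log n) μ := hp.mul_const _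
    rw [integral_congr_ae hpt, integral_sub h1 h2, integral_sub hplogp hplogq, integral_mul_const]

/-- **Donsker–Varadhan / Gibbs variational inequality, density form.** On a measure space `(α, μ)` let
`p ≥ 0` be integrable with mass `n = ∫ p dμ`, let `q > 0` a.e. with `∫ q dμ = 1`, and let `φ` be a test function,
with `p log p`, `p log q`, `φ p` and `e^φ q` integrable. Then
`∫ φ p dμ ≤ ∫ p log (p / (n q)) dμ + n · log ∫ e^φ q dμ`.
(Gibbs' inequality for the probability density `p / n` against the tilted density `e^φ q / ∫ e^φ q`; for
`n = 0` both sides vanish.) -/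
theorem integral_mul_le_klDens_add_mul_log {p q φ : α → ℝ} (hp0 : 0 ≤ᵐ[μ] p)
    (hq0 : ∀ᵐ x ∂μ, 0 < q x) (hq1 : ∫ x, q x ∂μ = 1) (hp : Integrable p μ)
    (hplogp : Integrable (fun x => p x * log (p x)) μ)
    (hplogq : Integrable (fun x => p x * log (q x)) μ)
    (hφp : Integrable (fun x => φ x * p x) μ)
    (hZ : Integrable (fun x => exp (φ x) * q x) μ) :
    ∫ x, φ x * p x ∂μ ≤
      ∫ x, p x * log (p x / ((∫ y, p y ∂μ) * q x)) ∂μ +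
        (∫ y, p y ∂μ) * log (∫ x, exp (φ x) * q x ∂μ) := by
  rw [integral_mul_log_div_eq hp0 hq0 hp hplogp hplogq]
  set n : ℝ := ∫ y, p y ∂μ with hn
  have hn0 : 0 ≤ n := integral_nonneg_of_ae hp0
  rcases hn0.eq_or_lt with hz | hpos
  · -- mass zero
    have hpz : p =ᵐ[μ] 0 := (integral_eq_zero_iff_of_nonneg_ae hp0 hp).1 hz.symm
    have h1 : (fun x => φ x * p x) =ᵐ[μ] fun _ => (0 : ℝ) := by
      filter_upwards [hpz] with x hx; simp [hx]
    have h2 : (fun x => p x * log (p x)) =ᵐ[μ] fun _ => (0 : ℝ) := by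
      filter_upwards [hpz] with x hx; simp [hx]
    have h3 : (fun x => p x * log (q x)) =ᵐ[μ] fun _ => (0 : ℝ) := by
      filter_upwards [hpz] with x hx; simp [hx]
    rw [integral_congr_ae h1, integral_congr_ae h2, integral_congr_ae h3, ← hz]
    simp
  · -- Gibbs' variational inequality for `ρ = p / n`, `V = -φ - log q`
    have hq1' : Integrable q μ := by
      by_contra h
      rw [integral_undef h] at hq1
      exact zero_ne_one hq1
    set ρ : α → ℝ := fun x => p x / n with hρ
    set V : α → ℝ := fun x => -φ x - log (q x) with hV
    have hρi : Integrable ρ μ := hp.div_const n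
    have hρ0 : 0 ≤ᵐ[μ] ρ := by
      filter_upwards [hp0] with x hx using div_nonneg hx hpos.le
    have hρ1 : ∫ x, ρ x ∂μ = 1 := by
      simp only [hρ]
      rw [integral_div, ← hn, div_self hpos.ne']
    have hρlog : Integrable (fun x => ρ x * log (ρ x)) μ := by
      have h' : Integrable (fun x => n⁻¹ * (p x * log (p x)) - (log n / n) * p x) μ :=
        (hplogp.const_mul _).sub (hp.const_mul _)
      refine h'.congr ?_
      filter_upwards [hp0] with x hx
      simp only [hρ]
      rcases hx.eq_or_lt with h0 | h0
      · rw [← h0]; simp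
      · rw [log_div h0.ne' hpos.ne']; field_simp
    have hVρ : Integrable (fun x => V x * ρ x) μ := by
      have h' : Integrable (fun x => -(n⁻¹ * (φ x * p x)) - n⁻¹ * (p x * log (q x))) μ :=
        (hφp.const_mul _).neg.sub (hplogq.const_mul _)
      refine h'.congr (Eventually.of_forall fun x => ?_)
      simp only [hV, hρ]; field_simp
    have hexpV : (fun x => exp (-V x)) =ᵐ[μ] fun x => exp (φ x) * q x := by
      filter_upwards [hq0] with x hx
      simp only [hV, neg_sub, sub_neg_eq_add]
      rw [exp_add, exp_log hx, mul_comm]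
    have hZ' : Integrable (fun x => exp (-V x)) μ := hZ.congr hexpV.symm
    have key := Literature.MeasureTheory.Jensen.neg_integral_mul_log_le_integral_mul_add_log_integral_exp_neg
      hρi hρ0 hρ1 hρlog hVρ hZ'
    rw [integral_congr_ae hexpV] at key
    -- evaluate the two sides of `key`
    have hL : ∫ x, ρ x * log (ρ x) ∂μ = n⁻¹ * ∫ x, p x * log (p x) ∂μ - log n := by
      have hpt : (fun x => ρ x * log (ρ x)) =ᵐ[μ] fun x => n⁻¹ * (p x * log (p x)) - (log n / n) * p x := by
        filter_upwards [hp0] with x hx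
        simp only [hρ]
        rcases hx.eq_or_lt with h0 | h0
        · rw [← h0]; simp
        · rw [log_div h0.ne' hpos.ne']; field_simp
      have i1 : Integrable (fun x => n⁻¹ * (p x * log (p x))) μ := hplogp.const_mul _
      have i2 : Integrable (fun x => (log n / n) * p x) μ := hp.const_mul _
      rw [integral_congr_ae hpt, integral_sub i1 i2, integral_const_mul, integral_const_mul, ← hn]
      field_simp
    have hR : ∫ x, V x * ρ x ∂μ = -(n⁻¹ * ∫ x, φ x * p x ∂μ) - n⁻¹ * ∫ x, p x * log (q x) ∂μ := by
      have hpt : (fun x => V x * ρ x) = fun x => -(n⁻¹ * (φ x * p x)) - n⁻¹ * (p x * log (q x)) := by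
        funext x; simp only [hV, hρ]; field_simp
      have i1 : Integrable (fun x => -(n⁻¹ * (φ x * p x))) μ := (hφp.const_mul _).neg
      have i2 : Integrable (fun x => n⁻¹ * (p x * log (q x))) μ := hplogq.const_mul _
      rw [hpt, integral_sub i1 i2, integral_neg, integral_const_mul, integral_const_mul]
    rw [hL, hR] at key
    -- multiply through by `n > 0`
    have key' := mul_le_mul_of_nonneg_left key hpos.le
    have e1 : n * -(n⁻¹ * ∫ x, p x * log (p x) ∂μ - log n) = -∫ x, p x * log (p x) ∂μ + n * log n := by
      field_simp; ring
    have e2 : n * (-(n⁻¹ * ∫ x, φ x * p x ∂μ) - n⁻¹ * ∫ x, p x * log (q x) ∂μ +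
        log (∫ x, exp (φ x) * q x ∂μ)) =
        -∫ x, φ x * p x ∂μ - ∫ x, p x * log (q x) ∂μ + n * log (∫ x, exp (φ x) * q x ∂μ) := by
      field_simp
    rw [e1, e2] at key'
    linarith

/-- **Gibbs' inequality, density form**: `0 ≤ ∫ p log (p / (n q)) dμ` (`n = ∫ p dμ`), i.e. the relative entropy
of `p / n` with respect to the probability density `q` is nonnegative (the case `φ = 0` of
`integral_mul_le_klDens_add_mul_log`; requires `q` integrable, which `∫ q = 1` forces). -/
theorem klDens_nonneg {p q : α → ℝ} (hp0 : 0 ≤ᵐ[μ] p) (hq0 : ∀ᵐ x ∂μ, 0 < q x) (hq1 : ∫ x, q x ∂μ = 1)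
    (hp : Integrable p μ) (hplogp : Integrable (fun x => p x * log (p x)) μ)
    (hplogq : Integrable (fun x => p x * log (q x)) μ) :
    0 ≤ ∫ x, p x * log (p x / ((∫ y, p y ∂μ) * q x)) ∂μ := by
  have hq1' : Integrable q μ := by
    by_contra h
    rw [integral_undef h] at hq1
    exact zero_ne_one hq1
  have h := integral_mul_le_klDens_add_mul_log (φ := fun _ => (0 : ℝ)) hp0 hq0 hq1 hp hplogp hplogq
    (by simp) (by simpa using hq1')
  simp only [zero_mul, integral_zero, Real.exp_zero, one_mul, hq1, log_one, mul_zero, add_zero] at h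
  exact h

/-- **The transfer form.** Under the hypotheses of `integral_mul_le_klDens_add_mul_log`:
`n · (1 − ∫ e^φ q dμ) − ∫ p log (p / (n q)) dμ ≤ −∫ φ p dμ` — the chaotic exponential DEFECT of the test
function, weighted by the mass, minus the relative entropy, bounds the realised action `−∫ φ p` from below
(`log u ≤ u − 1` applied to `u = ∫ e^φ q > 0`). With `φ = ½ ΔΛ` this is the step
"residue ⇒ one-sided chaos" of the line. -/
theorem mul_one_sub_integral_exp_sub_klDens_le {p q φ : α → ℝ} (hp0 : 0 ≤ᵐ[μ] p)
    (hq0 : ∀ᵐ x ∂μ, 0 < q x) (hq1 : ∫ x, q x ∂μ = 1) (hp : Integrable p μ)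
    (hplogp : Integrable (fun x => p x * log (p x)) μ)
    (hplogq : Integrable (fun x => p x * log (q x)) μ)
    (hφp : Integrable (fun x => φ x * p x) μ)
    (hZ : Integrable (fun x => exp (φ x) * q x) μ) :
    (∫ y, p y ∂μ) * (1 - ∫ x, exp (φ x) * q x ∂μ) - ∫ x, p x * log (p x / ((∫ y, p y ∂μ) * q x)) ∂μ ≤
      -∫ x, φ x * p x ∂μ := by
  have h := integral_mul_le_klDens_add_mul_log hp0 hq0 hq1 hp hplogp hplogq hφp hZ
  have hn0 : 0 ≤ ∫ y, p y ∂μ := integral_nonneg_of_ae hp0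
  -- `∫ e^φ q > 0`: `μ ≠ 0` since `∫ q = 1`
  haveI : NeZero μ := ⟨fun hμ => by simp [hμ] at hq1⟩
  have hZpos : 0 < ∫ x, exp (φ x) * q x ∂μ := by
    have hpos : ∀ᵐ x ∂μ, 0 < exp (φ x) * q x := by
      filter_upwards [hq0] with x hx using mul_pos (exp_pos _) hx
    have hnn : 0 ≤ᵐ[μ] fun x => exp (φ x) * q x := hpos.mono fun x hx => hx.le
    rcases (integral_nonneg_of_ae hnn).eq_or_lt with hz | hlt
    · exfalso
      have hae := (integral_eq_zero_iff_of_nonneg_ae hnn hZ).1 hz.symm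
      have hF : ∀ᵐ x ∂μ, False := by
        filter_upwards [hae, hpos] with x hx hx'
        simp only [Pi.zero_apply] at hx
        exact hx'.ne' hx
      have hμ : μ = 0 := Measure.measure_univ_eq_zero.1 (by simpa using ae_iff.1 hF)
      exact (NeZero.ne μ) hμ
    · exact hlt
  have hlog : log (∫ x, exp (φ x) * q x ∂μ) ≤ (∫ x, exp (φ x) * q x ∂μ) - 1 := log_le_sub_one_of_pos hZpos
  nlinarith [mul_le_mul_of_nonneg_left hlog hn0]

end DVTransfer

/-! ## Registered anchor of this support file -/

/-- ANCHOR (registered helper stub `bhDVTransfer_dv_anchor` of the crux item): the Donsker–Varadhan / Gibbs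
variational inequality in density form on a general measure space — for an a.e. nonnegative integrable density `p`
of mass `n`, an a.e. positive probability density `q` and a test function `φ` (with `p log p`, `p log q`, `φ p`,
`e^φ q` integrable), `∫ φ p ≤ ∫ p log (p/(n q)) + n log ∫ e^φ q`. -/
theorem bhDVTransfer_dv_anchor : ∀ {α : Type*} [MeasurableSpace α] (μ : MeasureTheory.Measure α) (p q φ : α → ℝ), (0 ≤ᵐ[μ] p) → (∀ᵐ x ∂μ, 0 < q x) → ∫ x, q x ∂μ = 1 → MeasureTheory.Integrable p μ → MeasureTheory.Integrable (fun x => p x * Real.log (p x)) μ → MeasureTheory.Integrable (fun x => p x * Real.log (q x)) μ → MeasureTheory.Integrable (fun x => φ x * p x) μ → MeasureTheory.Integrable (fun x => Real.exp (φ x) * q x) μ → ∫ x, φ x * p x ∂μ ≤ ∫ x, p x * Real.log (p x / ((∫ y, p y ∂μ) * q x)) ∂μ + (∫ y, p y ∂μ) * Real.log (∫ x, Real.exp (φ x) * q x ∂μ) :=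
  fun μ _ _ _ hp0 hq0 hq1 hp hplogp hplogq hφp hZ =>
    DVTransfer.integral_mul_le_klDens_add_mul_log (μ := μ) hp0 hq0 hq1 hp hplogp hplogq hφp hZ

end

end Summit.AtomisticToContinuum.HydrodynamicLimit.Theorems.BlockHDissipation
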